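import Literature.Analysis.FluidPDE.FlatSwirlGauge
import Summits.NavierStokesRegularity.NavierStokesRegularity.Theses.FlatSwirlGauge

/-!
# Route FlatSwirlGauge — the axisymmetric anchor `AxisymmetricSwirlFlat`

Closes item `stmt-NavierStokesRegularity-1256` of route `FlatSwirlGauge` (NavierStokesRegularity):
the exactly-flat case of the v0 rendering of the flat swirl gauge is an identity. For a classical
Navier–Stokes solution on `ℝ³ × [0, T)` (any `ν`, no force) with axisymmetric velocity and
axisymmetric pressure, the swirl `Γ = swirl (u t) = x₀u₁ − x₁u₀ = r u_θ` satisfies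

* (a) `⟪curl u, ∇Γ⟫ = 0` at EVERY point (the swirl is a first integral of the vorticity) —
  `Literature.Analysis.FluidPDE.IsAxisymmetric.inner_curl_gradient_swirl`;
* (b) for `0 < t < T` and off the axis, the flat transport clause with `α = Γ`, `b = −(2/r) e_r`:
  `∂ₜΓ + (u·∇)Γ = ν (ΔΓ + ⟪−(2/r) e_r, ∇Γ⟫)` — KNSS 2009, eq. (1.8), in-tree
  `Literature.Analysis.FluidPDE.swirl_transport_holds`, repackaged with the two-sided time
  derivative as `Literature.Analysis.FluidPDE.IsClassicalNSSolutionOn.deriv_swirl_transport`.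

Both ingredients are proved in `Literature/Analysis/FluidPDE/FlatSwirlGauge.lean`; this file only
assembles them into the route decl, literally.

## References

* G. Koch, N. Nadirashvili, G. Seregin, V. Šverák, *Liouville theorems for the Navier–Stokes
  equations and applications*, Acta Math. 203 (2009) 83–105, eq. (1.8). [KNSS2009]
-/

namespace Summit.NavierStokesRegularity.NavierStokesRegularity.Theorems

open Literature.Analysis.FluidPDE

/-- **The axisymmetric anchor of the flat swirl gauge** (item `stmt-NavierStokesRegularity-1256`,
route `FlatSwirlGauge`): for a classical Navier–Stokes solution on `ℝ³ × [0, T)` with axisymmetric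
velocity and pressure, `Γ = swirl (u t)` satisfies `⟪curl (u t) x, ∇Γ x⟫ = 0` at every point and,
for `0 < t < T` off the axis (`cylRadius x ≠ 0`),
`∂ₜΓ + (u·∇)Γ = ν (ΔΓ + ⟪−(2/r) e_r, ∇Γ⟫)` (KNSS 2009, eq. (1.8)). Direct assembly of
`IsAxisymmetric.inner_curl_gradient_swirl` and `IsClassicalNSSolutionOn.deriv_swirl_transport`. -/
theorem flatSwirlGauge_axisymmetricSwirlFlat_proof :
    Summit.NavierStokesRegularity.NavierStokesRegularity.Theses.FlatSwirlGauge.AxisymmetricSwirlFlat := by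
  intro ν T u p h hu hp t ht x
  exact ⟨(hu t ⟨ht.1.le, ht.2⟩).inner_curl_gradient_swirl x,
    fun hx => h.deriv_swirl_transport hu hp ht hx⟩

end Summit.NavierStokesRegularity.NavierStokesRegularity.Theorems
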